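/- Copyright: the b2b-balaban cell (near-miss cell 7), T⁴-continuum fan-out; row NE7b OWNER lineage `t4-ne7b-p1`
(gen 58) — the refuter's located value note PRICING-NE7b v31 F176 (3)(b) in the kernel: «A MEMBER-EXTENSIVE CURLY
ENVELOPE IS A SHIFT OF THE FIBRE-SHARE LETTERS».  Released under the licence of the surrounding project. -/
import Summits.QuantumFields.BalabanUV.T4Continuum.Support.HistoryBankingFibreEnvelope

/-!
# (ρ2) by value: a curly envelope EXTENSIVE IN THE KEY's MEMBERS is charged to (ρ3)'s per-event share letters — the
fibre-mass junction with a k-uniform envelope `W₀` and the share table shifted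

Summits-side support leaf of the T⁴-continuum cell (rung (B)+1 on a FINITE torus only; NOT infinite volume, NOT the
mass gap, NOT the Clay statement; NOT a proof of the spine estimate NE7b — the cell's OWN estimate, NOT PRINTED, NOT
PROVED).  [folklore] real algebra over the END's fibre multiplicity (`HistoryPriceKeys.MULTOf`, node sums
`HistoryPriceNodeSum.nsum`) and the owner's g57 junction (`HistoryBankingFibreEnvelope.fibreMass_of_supSum_count_MULTOf`);
no `structure`, no `[cite:]` tag, no `def … : Prop`, nothing of Bałaban's, zero `sorry`.  B16 = [Balaban1989LargeFieldII]
pp. 388–390 — (1.97) «|F(X′)| ≤ c₁ exp(−(1+β)κ d_k(X′))», c₁ ∈ {exp(−p₀(g_k)), α^{1∕3}} (p. 390 l. 1–3), the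
exponentiation (1.98) «{ } = exp R′^{(k)} = exp Σ_X R′^{(k)}(X)» and the bounds (1.99)∕(1.100) — is quoted as the LOCATOR
of the value being booked; nothing printed is asserted.

WHY.  (ρ2) of the (α) record of record is, after g57, ONE inequality per cutoff, source and bad key: `supSum kmemA K k
(cwOf Φf t) ≤ W K`, its VALUE `W K` classed T∕PARAMETRIC — «print's claim, `≤ W∞` T-extensive» (refuter v19 F76 (iii),
R-OWNER-57-1 (1)).  PRICING-NE7b v31 F176 (3) located the T-dependence: under (1.98) the curly bracket is bounded by
`exp (c₁ · #admissible domains)`, «EXTENSIVE in the key's member content, hence per-member chargeable (into (ρ3)'s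
`MULTOf` letters) or T-dependent, never k-uniform for free».  This file is the FIRST ALTERNATIVE in the kernel: an
envelope of the form `W₀ · MULTOf ψ k` — a k-uniform constant times a product over the key's members of `exp` of a
per-event node sum `ψ` (e.g. `ψ := fun _ => c₁`: `exp (c₁ · #nodes of the member's genealogy)`) — feeds the SAME
fibre-mass junction with the k-uniform `W₀` in place of `W K` and (ρ3)'s share table SHIFTED `φ ↦ φ + ψ`; nothing else
changes.  So «T-extensive» is not forced on (ρ2)'s value: what is extensive in the MEMBERS is a re-lettering of (ρ3),
what is extensive in the TORUS is not covered here (and is what a RELATIVE two-run bound must cancel — R-class as ever).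

WHAT.  §1 `MULTOf_add` (`MULTOf (φ + ψ) k = MULTOf φ k · MULTOf ψ k`, from `nsum_add`), `MULTOf_mono` (monotone in the
letter), `MULTOf_const_eq` (`MULTOf (fun _ => c) k = ∏_{w ∈ k} exp (c · nsum 1 w.2.1)` — the constant share reads the
node count).  §2 **`fibreMass_charge`**: `Σ_{fibre} dmass ≤ (W₀ · MULTOf ψ k) · MULTOf φ k → Σ_{fibre} dmass ≤ W₀ · MULTOf
(φ + ψ) k` (pure algebra) and **`fibreMass_of_supSum_count_MULTOf_charged`** — g57's `fibreMass_of_supSum_count_MULTOf`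
with the SUPSUM hypothesis `supSum ≤ W₀ · MULTOf ψ k` and the conclusion `Σ_{τ ∈ fibre k} dmass τ ≤ W₀ · MULTOf (φ + ψ)
k`.  §3 a decided toy on g57's one-point skeleton: with the unit weight, `W₀ := 1∕2` FAILS as a plain envelope
(g57's `no_envelope_half`) but `W₀ := 1∕2` with the constant share `ψ := log 2` per event HOLDS
(`Toy.charged_half`, on the one-member key `{((), born e 0, ())}`) — the charge genuinely relaxes the k-uniform constant.

HONEST SCOPE.  Algebra over OUR carriers; which part of print's (1.98) exponent is member-extensive and which is
torus-extensive is the READING (ρ2) by value, untouched; `W₀`, `ψ`, `c₁` are letters, nothing valued.  BY-NAME EFFECT ON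
THE WALL: row `resum`∕(ρ) — (ρ2)'s VALUE residue WORDED «`W K = W₀ · MULTOf ψ k` admissible: member-extensive part =
shift of (ρ3)'s share table (kernel), `W₀` k-uniform = print's claim; torus-extensive part = the relative reading»;
R∕T-rows by count UNCHANGED.  NE7b NOT PRINTED ∕ NOT PROVED; spine 0∕9.  HONEST DEPENDENCY (cell): continuum YM on
T⁴ ⇐ BetaPertH ∧ nine spine estimates (0/9 proved); BetaPertH ⇐ (D1) ∧ (D4) ∧ CAP+tail; G-an2-4 gates asym, D1 and
NE2/3/4.  This file changes none of it.
-/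

open Finset
open Literature.MathematicalPhysics.QuantumFieldTheory.Balaban1983to89
open T4PersistenceDictionary T4LiveClassFibration
open Summit.QuantumFields.BalabanUV.T4Continuum.HistoryPriceNodeSum
open Summit.QuantumFields.BalabanUV.T4Continuum.HistoryPriceKeys
open Summit.QuantumFields.BalabanUV.T4Continuum.HistoryBankingFibreDecorKeys
open Summit.QuantumFields.BalabanUV.T4Continuum.HistoryBankingFibreDecorSlice
open Summit.QuantumFields.BalabanUV.T4Continuum.HistoryBankingFibreCount
open Summit.QuantumFields.BalabanUV.T4Continuum.HistoryBankingFibreEnvelope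
open Summit.QuantumFields.BalabanUV.T4Continuum.B16HistoryIndexedRepr

namespace Summit.QuantumFields.BalabanUV.T4Continuum.HistoryBankingFibreEnvelopeCharge

noncomputable section

/-! ## §1 The fibre multiplicity is multiplicative and monotone in the share letter -/

section Mult

variable {γ δ : Type*} (φ ψ : PEv → ℝ) (k : Finset (γ × Gen PEv × δ))

/-- **THE FIBRE MULTIPLICITY IS MULTIPLICATIVE IN THE SHARE LETTER**: `MULTOf (φ + ψ) k = MULTOf φ k · MULTOf ψ k`.
[folklore] -/
theorem MULTOf_add : MULTOf (fun e => φ e + ψ e) k = MULTOf φ k * MULTOf ψ k := by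
  unfold MULTOf
  rw [← Finset.prod_mul_distrib]
  exact Finset.prod_congr rfl fun w _ => by rw [nsum_add, Real.exp_add]

variable {φ ψ} in
/-- the fibre multiplicity is monotone in the share letter [folklore] -/
theorem MULTOf_mono (h : ∀ e, φ e ≤ ψ e) : MULTOf φ k ≤ MULTOf ψ k :=
  Finset.prod_le_prod (fun _ _ => (Real.exp_pos _).le) fun w _ => Real.exp_le_exp.2 (nsum_le_nsum h w.2.1)

/-- **A CONSTANT SHARE READS THE NODE COUNT**: `MULTOf (fun _ => c) k = ∏_{w ∈ k} exp (c · nsum 1 w.2.1)` — the member's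
genealogy contributes `exp c` per node (per admissible domain it names). [folklore] -/
theorem MULTOf_const_eq (c : ℝ) : MULTOf (fun _ => c) k = ∏ w ∈ k, Real.exp (c * nsum (fun _ => (1 : ℝ)) w.2.1) := by
  unfold MULTOf
  refine Finset.prod_congr rfl fun w _ => ?_
  congr 1
  induction w.2.1 with
  | born b j => simp
  | renew G e h ih => rw [nsum_renew, nsum_renew, ih]; ring
  | merge X Y e ihX ihY => rw [nsum_merge, nsum_merge, ihX, ihY]; ring

end Mult

/-! ## §2 The charge: a member-extensive envelope is a shift of the share table -/

section Charge

variable {γ δ : Type*}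

/-- **THE CHARGE** (pure algebra): a fibre mass below `(W₀ · MULTOf ψ k) · MULTOf φ k` is below `W₀ · MULTOf (φ + ψ) k`.
[folklore] -/
theorem fibreMass_charge {M W₀ : ℝ} (φ ψ : PEv → ℝ) (k : Finset (γ × Gen PEv × δ))
    (h : M ≤ W₀ * MULTOf ψ k * MULTOf φ k) : M ≤ W₀ * MULTOf (fun e => φ e + ψ e) k := by
  rw [MULTOf_add, mul_comm (MULTOf φ k), ← mul_assoc]
  exact h

variable {DomK : ℕ → Type*} {I : (K : ℕ) → HIndex (DomK K)}

/-- **(ρ) `FibreMass` FROM A MEMBER-EXTENSIVE SUPSUM ENVELOPE AND THE COUNT, THE SHARE TABLE SHIFTED** — g57's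
`fibreMass_of_supSum_count_MULTOf` with the SUPSUM hypothesis `supSum ≤ W₀ · MULTOf ψ k` (a k-uniform constant times a
per-member product of `exp` of per-event node sums) in place of `supSum ≤ W`: the conclusion keeps the k-uniform `W₀`
and charges `ψ` to the share letters, `Σ_{τ ∈ fibre k} dmass τ ≤ W₀ · MULTOf (φ + ψ) k`. [folklore] -/
theorem fibreMass_of_supSum_count_MULTOf_charged {β γ' δ' : Type*} [DecidableEq β] [DecidableEq γ'] [DecidableEq δ']
    (kmem : ℕ → HIndex.Idx I → Finset (γ' × Gen PEv × δ')) (K : ℕ) (k : Finset (γ' × Gen PEv × δ'))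
    (dmass cw : HIndex.Idx I → ℝ) (φ ψ : PEv → ℝ) {W₀ : ℝ} (C : γ' × Gen PEv × δ' → PEv → Finset β)
    (hS : supSum kmem K k cw ≤ W₀ * MULTOf ψ k)
    (hcount : ∀ (a : (I K).Adm) (c : (I K).HC),
      (pairsOf kmem K k a c).card ≤ ∏ w ∈ k, (decG (C w) w.2.1).card)
    (hfac : ∀ τ ∈ fibre kmem (HIndex.termSet I) K k, dmass τ ≤ cw τ)
    (hC : ∀ w ∈ k, ∀ e ∈ w.2.1.events, ((C w e).card : ℝ) ≤ Real.exp (φ e)) :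
    ∑ τ ∈ fibre kmem (HIndex.termSet I) K k, dmass τ ≤ W₀ * MULTOf (fun e => φ e + ψ e) k :=
  fibreMass_charge φ ψ k (fibreMass_of_supSum_count_MULTOf kmem K k dmass cw φ C hS hcount hfac hC)

/-- the same with a CONSTANT per-event charge `c` (the shape F176 (3) names: `exp (c₁ · #admissible domains)` per
member): `supSum ≤ W₀ · MULTOf (fun _ => c) k` ⇒ `Σ dmass ≤ W₀ · MULTOf (φ + c) k`. [folklore] -/
theorem fibreMass_of_supSum_count_MULTOf_charged_const {β γ' δ' : Type*} [DecidableEq β] [DecidableEq γ']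
    [DecidableEq δ'] (kmem : ℕ → HIndex.Idx I → Finset (γ' × Gen PEv × δ')) (K : ℕ) (k : Finset (γ' × Gen PEv × δ'))
    (dmass cw : HIndex.Idx I → ℝ) (φ : PEv → ℝ) (c : ℝ) {W₀ : ℝ} (C : γ' × Gen PEv × δ' → PEv → Finset β)
    (hS : supSum kmem K k cw ≤ W₀ * MULTOf (fun _ => c) k)
    (hcount : ∀ (a : (I K).Adm) (c' : (I K).HC),
      (pairsOf kmem K k a c').card ≤ ∏ w ∈ k, (decG (C w) w.2.1).card)
    (hfac : ∀ τ ∈ fibre kmem (HIndex.termSet I) K k, dmass τ ≤ cw τ)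
    (hC : ∀ w ∈ k, ∀ e ∈ w.2.1.events, ((C w e).card : ℝ) ≤ Real.exp (φ e)) :
    ∑ τ ∈ fibre kmem (HIndex.termSet I) K k, dmass τ ≤ W₀ * MULTOf (fun e => φ e + c) k :=
  fibreMass_of_supSum_count_MULTOf_charged kmem K k dmass cw φ (fun _ => c) C hS hcount hfac hC

end Charge

/-! ## §3 A decided toy: on g57's one-point skeleton the charge relaxes the k-uniform constant -/

namespace Toy

open HistoryBankingFibreCount.Toy HistoryBankingFibreEnvelope.Toy

/-- the fibre multiplicity of the one-member key `{((), born e 0, ())}` at the constant share `c` is `exp c` (one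
member, one node) [folklore] -/
theorem MULTOf_key₁ (e : PEv) (c : ℝ) :
    MULTOf (fun _ => c) ({((), Gen.born e 0, ())} : Finset (Unit × Gen PEv × Unit)) = Real.exp c := by
  unfold MULTOf
  rw [Finset.prod_singleton, nsum_born]

/-- **CONTENT**: the SUPSUM of the unit weight on the one fibre is `1` (g57's `supSum_const`), so the PLAIN envelope
`W₀ := 1∕2` fails (`1 ≤ 1∕2` is false — g57's `no_envelope_half`) while the CHARGED envelope `W₀ · MULTOf (fun _ => log 2)`
of the one-member key at the same `W₀ := 1∕2` holds with equality: `1 ≤ 1∕2 · exp (log 2)`. [folklore] -/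
theorem charged_half (K : ℕ) (e : PEv) :
    ¬ supSum kmem₁ K {()} (fun _ => (1 : ℝ)) ≤ 1 / 2 ∧
      supSum kmem₁ K {()} (fun _ => (1 : ℝ)) ≤
        1 / 2 * MULTOf (fun _ => Real.log 2) ({((), Gen.born e 0, ())} : Finset (Unit × Gen PEv × Unit)) := by
  rw [supSum_const, MULTOf_key₁, Real.exp_log (by norm_num : (0 : ℝ) < 2)]
  norm_num

end Toy

end

end Summit.QuantumFields.BalabanUV.T4Continuum.HistoryBankingFibreEnvelopeCharge
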